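import Literature.NumberTheory.GaloisRepresentations.ContinuousCohomologyCorankModPrime
import HarnessLib

/-!
# P412 in the kernel, II — Greenberg's one-prime specialisation step for corank Euler characteristics
# WITHOUT the hypothesis `H³ = 0`: `χ_{R'}(D[T]) = χ_R(D) + rank_{R'} H²(D)^∨[T] ≥ χ_R(D)`

Cell `bsd-2adic` (run/shared/lean/pub/bsd-2adic/), seat `bsd-2adic-t42` GEN 20 (pen RC-315 (b): discharge of the PRINT
binder P412 = `Greenberg1999.prop412_noFiniteSubmodule_H1Sigma_of_rank_one`). HONEST FRAMING: research route;
THEOREMS ONLY (no `def`, no named fact, no instance, no `sorry`); nothing booked; BSD is not proved by any of this.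
PARTITION: K4 PRINT binder P412 × all p — reduces-the-named-input-of; bears_on K4 19097
(`--supports stmt-BirchSwinnertonDyer-19097`).

## What

The engine lemma `alternatingSum_finrank_torsionBy_characterModule_H_eq` (`ContinuousCohomologyCorankModPrime.lean`,
Greenberg 2006 p. 368 L34–52) needs `H³(Γ, A) = 0` — false for `Γ = G_{ℚ,S}` at `p = 2` (the real place:
Greenberg LNM 1716 p. 117 «`Gal(F_Σ/F)` doesn't have finite `p`-cohomological dimension»). The hypothesis is used
at ONE point only: to kill the correction term `rank_{R'} H²(Γ, D)^∨[T]` (the dual of `H²(Γ, D)/T`, which embeds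
in `H³(Γ, A)`). Dropping it, the same bookkeeping (long exact sequence of `0 → A → D →(T·) D → 0` dualised, and
`rank_R X = rank_{R'} X/TX − rank_{R'} X[T]`) gives the IDENTITY WITH CORRECTION TERM and hence the INEQUALITY

  `Σ_{i≤2} (−1)ⁱ rank_{R'} Hⁱ(Γ, A)^∨[T] = Σ_{i≤2} (−1)ⁱ rank_R Hⁱ(Γ, D)^∨ + rank_{R'} H²(Γ, D)^∨[T] ≥ Σ_{i≤2} (−1)ⁱ rank_R Hⁱ(Γ, D)^∨`

— exactly the direction consumed by Greenberg's corank count (LNM 1716 p. 114: from `corank_Λ H¹ = [F:ℚ]` one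
needs only `corank_Λ H² ≤ corank_Λ H¹ + corank_Λ H⁰ − δ`). Valid for EVERY compact `Γ`, in particular
`G_{ℚ,S}` at `p = 2`.

* `alternatingSum_finrank_torsionBy_characterModule_H_eq_add` — the identity with the correction term;
* `alternatingSum_finrank_characterModule_H_le` — the inequality.

References: [Greenberg2006] §4 A (proof of Props. 4.1/4.2, p. 368 L25–52); [GreenbergLNM1716] §4 pp. 114, 117.
-/

set_option autoImplicit false
set_option linter.dupNamespace false

noncomputable section

open CategoryTheory Limits

namespace Summit.BirchSwinnertonDyer.BirchSwinnertonDyer.Theorems.P412Kernel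

open _root_.TopRep _root_.ContRepresentation _root_.ContinuousCohomology
open _root_.Module Submodule Literature.Algebra.Module Literature.NumberTheory.GaloisRepresentations

variable {R : Type} [CommRing R] [TopologicalSpace R] [IsNoetherianRing R] [IsDomain R]
variable {Γ : Type} [Group Γ] [TopologicalSpace Γ] [IsTopologicalGroup Γ] [CompactSpace Γ]
variable {M₁ : Type} [AddCommGroup M₁] [Module R M₁] [TopologicalSpace M₁] [DiscreteTopology M₁]
  [ContinuousSMul R M₁]
variable {M₂ : Type} [AddCommGroup M₂] [Module R M₂] [TopologicalSpace M₂] [DiscreteTopology M₂]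
  [ContinuousSMul R M₂]

/-- **Greenberg's reduction step for Euler characteristics WITHOUT `cd ≤ 2`, identity form.** Let `T ≠ 0` be a
prime element of the Noetherian domain `R`, `R' = R/(T)`, and `0 → A →ι D →(T·) D → 0` a short exact sequence of
discrete `Γ`-modules over `R` (`D` is `T`-divisible, `A = D[T]`) with all `Hⁱ(Γ, ·)^∨` finitely generated. Then
`Σ_{i=0}^{2} (−1)ⁱ rank_{R'} Hⁱ(Γ, A)^∨[T] = Σ_{i=0}^{2} (−1)ⁱ rank_R Hⁱ(Γ, D)^∨ + rank_{R'} H²(Γ, D)^∨[T]`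
(no hypothesis on `H³(Γ, A)`; the last term is the dual of `H²(Γ, D)/T·H²(Γ, D) ⊆ H³(Γ, A)`).
[cite: Greenberg2006, §4 A (proof of Props. 4.1/4.2, p. 368 L34–52)] [cite: GreenbergLNM1716, §4 p. 117] -/
theorem alternatingSum_finrank_torsionBy_characterModule_H_eq_add {T : R} (hT0 : T ≠ 0)
    (hT : (Ideal.span {T}).IsPrime) (σA : ContinuousRep Γ R M₁) (σ : ContinuousRep Γ R M₂)
    {ι : σA.toTopRep ⟶ σ.toTopRep} {μ : σ.toTopRep ⟶ σ.toTopRep} (h : IsSES ι μ)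
    (hμ : ∀ m : M₂, μ.hom m = T • m) (hA : ∀ a : M₁, T • a = 0)
    (hfin : ∀ n, Module.Finite R (CharacterModule (σ.H n)))
    (hfinA : ∀ n, Module.Finite R (CharacterModule (σA.H n))) :
    (finrank (R ⧸ Ideal.span {T}) (torsionBy R (CharacterModule (σA.H 0)) T) : ℤ) -
        finrank (R ⧸ Ideal.span {T}) (torsionBy R (CharacterModule (σA.H 1)) T) +
        finrank (R ⧸ Ideal.span {T}) (torsionBy R (CharacterModule (σA.H 2)) T) =
      (finrank R (CharacterModule (σ.H 0)) : ℤ) - finrank R (CharacterModule (σ.H 1)) +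
        finrank R (CharacterModule (σ.H 2)) +
        finrank (R ⧸ Ideal.span {T}) (torsionBy R (CharacterModule (σ.H 2)) T) := by
  haveI : IsDomain (R ⧸ Ideal.span {T}) := (Ideal.Quotient.isDomain_iff_prime _).mpr hT
  haveI := hfin; haveI := hfinA
  -- `T` kills `Hⁿ(Γ, A)` and its dual
  have hZ : ∀ (n : ℕ) (z : CharacterModule (σA.H n)), T • z = 0 := fun n z => by
    ext c
    have h0 : T • c = 0 := σA.smul_continuousCohomology_eq_zero T hA n c
    rw [CharacterModule.smul_apply, h0, map_zero]
    rfl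
  -- degree 0: `(H⁰ A)^∨ ≅ X⁰/TX⁰`
  obtain ⟨ι₀, hι₀, e₀⟩ := h.exists_exact_smul_zero hμ
  have d0 := finrank_torsionBy_eq_of_surjective T (CharacterModule.dual ι₀) (hZ 0)
    (by simpa only [CharacterModule.dual_smul_id] using CharacterModule.exact_dual e₀)
    (CharacterModule.dual_surjective_of_injective _ hι₀)
  -- degrees 1, 2: `(Hⁿ⁺¹ A)^∨` is an extension of `Xⁿ[T]` by `Xⁿ⁺¹/TXⁿ⁺¹`
  have dsucc : ∀ n : ℕ, finrank (R ⧸ Ideal.span {T}) (torsionBy R (CharacterModule (σA.H (n + 1))) T) =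
      finrank (R ⧸ Ideal.span {T})
          (CharacterModule (σ.H (n + 1)) ⧸ (Ideal.span {T} • ⊤ : Submodule R (CharacterModule (σ.H (n + 1))))) +
        finrank (R ⧸ Ideal.span {T}) (torsionBy R (CharacterModule (σ.H n)) T) := fun n => by
    obtain ⟨δ, ι₁, e1, e2, e3⟩ := h.exists_exact_smul hμ n
    exact finrank_torsionBy_eq_add_of_exact T (CharacterModule.dual ι₁) (CharacterModule.dual δ)
      (hZ (n + 1)) (by simpa only [CharacterModule.dual_smul_id] using CharacterModule.exact_dual e3)
      (CharacterModule.exact_dual e2)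
      (by simpa only [CharacterModule.dual_smul_id] using CharacterModule.exact_dual e1)
  -- `rank_R Xⁿ = rank_{R'} Xⁿ/TXⁿ − rank_{R'} Xⁿ[T]`
  have r := fun n => finrank_eq_finrank_quotient_sub_finrank_torsionBy hT0 hT (CharacterModule (σ.H n))
  have r0 := r 0; have r1 := r 1; have r2 := r 2
  have d1 := dsucc 0; have d2 := dsucc 1
  zify at d0 d1 d2
  linarith

/-- **The INEQUALITY `χ_{R'}(A) ≥ χ_R(D)`** (correction term `≥ 0`): for `0 → A → D →(T·) D → 0` as above,
`Σ_{i≤2} (−1)ⁱ rank_R Hⁱ(Γ, D)^∨ ≤ Σ_{i≤2} (−1)ⁱ rank_{R'} Hⁱ(Γ, A)^∨[T]` — the half of Greenberg's specialisation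
step that survives a real place at `p = 2`, and the half his corank count (LNM 1716 p. 114) consumes.
[cite: Greenberg2006, §4 A (proof of Props. 4.1/4.2, p. 368 L34–52)] [cite: GreenbergLNM1716, §4 pp. 114, 117] -/
theorem alternatingSum_finrank_characterModule_H_le {T : R} (hT0 : T ≠ 0)
    (hT : (Ideal.span {T}).IsPrime) (σA : ContinuousRep Γ R M₁) (σ : ContinuousRep Γ R M₂)
    {ι : σA.toTopRep ⟶ σ.toTopRep} {μ : σ.toTopRep ⟶ σ.toTopRep} (h : IsSES ι μ)
    (hμ : ∀ m : M₂, μ.hom m = T • m) (hA : ∀ a : M₁, T • a = 0)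
    (hfin : ∀ n, Module.Finite R (CharacterModule (σ.H n)))
    (hfinA : ∀ n, Module.Finite R (CharacterModule (σA.H n))) :
    (finrank R (CharacterModule (σ.H 0)) : ℤ) - finrank R (CharacterModule (σ.H 1)) +
        finrank R (CharacterModule (σ.H 2)) ≤
      (finrank (R ⧸ Ideal.span {T}) (torsionBy R (CharacterModule (σA.H 0)) T) : ℤ) -
        finrank (R ⧸ Ideal.span {T}) (torsionBy R (CharacterModule (σA.H 1)) T) +
        finrank (R ⧸ Ideal.span {T}) (torsionBy R (CharacterModule (σA.H 2)) T) := by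
  rw [alternatingSum_finrank_torsionBy_characterModule_H_eq_add hT0 hT σA σ h hμ hA hfin hfinA]
  have : (0 : ℤ) ≤ finrank (R ⧸ Ideal.span {T}) (torsionBy R (CharacterModule (σ.H 2)) T) := by positivity
  linarith

end Summit.BirchSwinnertonDyer.BirchSwinnertonDyer.Theorems.P412Kernel

end
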